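import Summits.RiemannHypothesis.RiemannHypothesis.Theorems.TiltedLandingLaw421R3Lens1PinningIsoB
import Summits.RiemannHypothesis.RiemannHypothesis.Theorems.TiltedLandingLaw421R3Lens1ArcSignA

/-!
# TiltedLandingLaw421R3 — lens-1 (O6-a, director-rh g24): RUNG 1 of the arc-sign ladder — `pinning_of_arcSignClear` PROVED (part B)

LENS-1 gen-6 module image `rh33346-cover/lens-1/ArcSignB-v1.lean` (landing target `…/Theorems/TiltedLandingLaw421R3Lens1ArcSignB.lean`;
imports `…R3Lens1PinningIsoB` (`RhW08.Lens1PinningIso.exists_uniform_far_gap`, `exists_nl_margin`, `JensenIsolated`,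
`pinning_of_jensenIsolated'`, `TopPinningCrossing`; image `lens-1/PinningIsoB-v1.lean` 830c0db8 until it is tree) and part A
`…R3Lens1ArcSignA` (`RhW08.Lens1ArcSign.disc_census`, `no_nonreal_zero_of_disc`); namespace `RhW08.Lens1ArcSign`; 0 `sorry`,
no instances / notation, nothing inlined; checked BY CHAIN over those two images until both are tree).

CONTENT (the `m̃ = 0` rung of the arc-sign ladder for the OPEN law `RhW08.Lens1Pinning.TopPinning`):
§1 `exists_child_margin` — finitely many zeros of `f^{(j+1)}` near `a`'s closed disc (strip + box), so a non-real one within `Im a + m′`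
   of `Re a` is already a `NestedStep` child (`m′ ∈ (0,1]`).
§2 ★★★ `pinning_of_arcSignClear` — RUNG 1: on a legal frame (`EngineHyps5 2 …`), an upper zero `a` of `f^{(j)}` whose small Jensen
   circles `|w − Re a| = Im a + δ` (`0 < δ < d₀`) carry `Im (f^{(j+1)}/f^{(j)}) < 0` on their UPPER half (ARC-SIGN CLEARANCE, `m̃(a) = 0`;
   the lower half follows by conjugation) satisfies the LITERAL `TopPinning` disjunction: a non-real zero of `f^{(j+1)}` in the CLOSED
   Jensen disc (`NestedStep a w`) or an NL event of level `j` in the CLOSED base `|x − Re a| ≤ Im a`.  MECHANISM: pick a GENERIC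
   `δ < min(d₀, NL margin, child margin)` whose feet `Re a ± (Im a + δ)` miss the finitely many zeros of `f^{(j)} f^{(j+1)}`
   (`RhW08.SuccB.finite_zeros_box`, `Set.Ioo_infinite`); the disc census `2 (N_D(G′) − N_D(G)) = sgn φ(left) − sgn φ(right)` (part A)
   and the real Rolle identity on the base (`…JensenWindow.rolleIdentity_of_localB_core`, from the local Laguerre law B — else an NL
   event, `RhW08.QuadW.nlEventOf_of_not_localB`, within the margin) leave no room for a non-real zero of `G` in the disc once every
   critical point in the disc is real (else it is a `NestedStep` child) — but `a` itself is one.  NO isolation, NO clean feet, NO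
   smallness: the hypothesis is exactly the sign of ONE function on ONE family of arcs.
§3 `ArcSignClear` (the hypothesis as a `Prop`), `topPinning_case_arcSignClear`; ★ `arcSignClear_of_jensenIsolated` — a JENSEN-ISOLATED
   zero is arc-sign clear (every point of a circle of radius `< Im a + g`, `g` the uniform far gap, is Jensen-clear for `f^{(j)}`, and
   the Jensen–Nagy sign `…JensenWindow.im_mul_im_logDeriv_neg` applies) — so RUNG 1 SUBSUMES (3p)″ `pinning_of_jensenIsolated'`
   and reaches into the crossing population (`m̃ = 0` there: 11.1 % registry-facing,
   instr-1 `INSTRUMENT-v3-TCROSS.md` §5).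
§4 `TopPinningArcResidual` — the typed residual of the law after RUNG 1 (crossing mates AND `¬ ArcSignClear`, i.e. `m̃ ≥ 1`), with the
   exact split `topPinningCrossing_of_arcResidual` / `topPinning_of_arcResidual` / `arcResidual_of_topPinning`.  OPEN.

HONEST LABEL: RUNG 1 is a special case PROVED ≠ the law; `TopPinning` / `TopPinningCrossing` / `TopPinningArcResidual` /
`RegUmbrella11S` / 33346 / 33347 stay OPEN; nothing here bears on the truth of RH; RH is not proved; checked ≠ proved.
-/

noncomputable section

namespace RhW08.Lens1ArcSign

open Complex Set Metric
open scoped ComplexConjugate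
open Literature.Analysis.Complex
open Summit.RiemannHypothesis.RiemannHypothesis.Theorems.Splittings.JensenWindow
open RhIdea6.G17.W07C7 RhIdea6.G17.W07C7.Rev6 RhIdea6.G18.W07C8.Law421BirthS RhIdea6.G19.W07C11.Seam
open RhIdea6.G20.W07C12.Frac RhIdea6.G20.W07C12.StColP RhW07.C12.FieldSplit RhIdea6.G21.W07C13.TentMax
open RhW07.C14.TwoSided RhW07.C14.Classes RhW07.C14.Lineage RhW07.C14.Booking
open RhW07.C13.Heredity RhIdea6.G22.W07C15pre.Injection RhW07.E3.Cell RhW07.E3.Lit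
open RhW08.Round1 RhW08.StSwap RhW08.Round2 RhW08.QuadW RhW08.SealSwapQ RhW08.SealSwap RhW08.SuccB RhW08.SuccSplit
open RhW08.SuccTheft RhW08.Column RhW08.Hurwitz RhW08.ClusterQ RhW08.ClusterQM RhW08.NewtonDoor RhW08.NewtonDoorGenusOne RhW08.PurseP
open RhW08.Lens1SignCut RhW08.Lens1Coverage RhW08.IsolatedTilt RhW08.Lens1Pinning RhW08.Lens1PinningIso

/-! ## §1 The child margin -/

/-- CHILD MARGIN: on a legal frame with `f^{(j+1)} ≢ 0`, there is `m′ ∈ (0,1]` such that every NON-REAL zero `w` of `f^{(j+1)}` with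
`‖w − Re a‖ < Im a + m′` lies in `a`'s CLOSED Jensen disc (`NestedStep a w`): finitely many zeros in the box (strip `|Im| ≤ Hs`). -/
theorem exists_child_margin {η : ℝ} {f : ℂ → ℂ} {x₀ s hmax R Hs : ℝ} {B : ℕ} (hE : EngineHyps5 2 η f x₀ s hmax R Hs B)
    {j : ℕ} (hne : iteratedDeriv (j + 1) f ≠ 0) {a : ℂ} (hapos : 0 < a.im) :
    ∃ m : ℝ, 0 < m ∧ m ≤ 1 ∧ ∀ w : ℂ, iteratedDeriv (j + 1) f w = 0 → w.im ≠ 0 →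
      ‖w - (a.re : ℂ)‖ < a.im + m → NestedStep a w := by
  have hf : RealEntireLt2 f := realEntireLt2_of_hyps hE
  have hG'd : Differentiable ℂ (iteratedDeriv (j + 1) f) := differentiable_iteratedDeriv_of_entire hf.diff (j + 1)
  have hHs : 0 ≤ Hs := hE.2.2.2.2.2.2.2.1
  have hstrip : ∀ c : ℂ, iteratedDeriv (j + 1) f c = 0 → |c.im| ≤ Hs := fun c hc => abs_im_le_of_level hE hne hc
  set L : ℝ := a.im + 2 with hL
  have hz₀ : ((a.re : ℂ)) ∈ Ioo (a.re - L) (a.re + L) ×ℂ Ioo (-(Hs + 1)) (Hs + 1) :=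
    ofReal_mem_box (by rw [sub_self, abs_zero]; linarith) hHs
  have hfin := finite_zeros_box hG'd hne hz₀
  set T : Set ℂ := {w : ℂ | iteratedDeriv (j + 1) f w = 0 ∧ w ∈ Ioo (a.re - L) (a.re + L) ×ℂ Ioo (-(Hs + 1)) (Hs + 1)} ∩
    {w : ℂ | a.im < ‖w - (a.re : ℂ)‖} with hT
  have hTfin : T.Finite := hfin.inter_of_left _
  have key : ∀ m : ℝ, m ≤ 1 → (∀ w ∈ T, m ≤ ‖w - (a.re : ℂ)‖ - a.im) →
      ∀ w : ℂ, iteratedDeriv (j + 1) f w = 0 → w.im ≠ 0 → ‖w - (a.re : ℂ)‖ < a.im + m → NestedStep a w := by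
    intro m hm1 hmT w hw _ hlt
    have hle : ‖w - (a.re : ℂ)‖ ≤ a.im := by
      by_contra hgt
      rw [not_le] at hgt
      have hbox : w ∈ Ioo (a.re - L) (a.re + L) ×ℂ Ioo (-(Hs + 1)) (Hs + 1) := by
        have h1 := lt_of_le_of_lt (abs_re_le_norm (w - a.re)) hlt
        rw [sub_re, ofReal_re, abs_lt] at h1
        have h2 := hstrip w hw
        rw [abs_le] at h2
        exact mem_reProdIm.2 ⟨⟨by linarith [h1.1], by linarith [h1.2]⟩, ⟨by linarith [h2.1], by linarith [h2.2]⟩⟩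
      have h3 := hmT w ⟨⟨hw, hbox⟩, hgt⟩
      linarith
    have hsq : (w.re - a.re) ^ 2 + w.im ^ 2 = ‖w - (a.re : ℂ)‖ ^ 2 := by
      rw [Complex.sq_norm, Complex.normSq_apply, sub_re, ofReal_re, sub_im, ofReal_im, sub_zero]; ring
    show (w.re - a.re) ^ 2 + w.im ^ 2 ≤ a.im ^ 2
    rw [hsq]
    exact pow_le_pow_left₀ (norm_nonneg _) hle 2
  by_cases hTe : T.Nonempty
  · obtain ⟨w₀, hw₀, hmin⟩ := Set.exists_min_image T (fun w => ‖w - (a.re : ℂ)‖ - a.im) hTfin hTe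
    have h0 : 0 < ‖w₀ - (a.re : ℂ)‖ - a.im := by
      have h := hw₀.2
      simp only [mem_setOf_eq] at h
      linarith
    refine ⟨min (‖w₀ - (a.re : ℂ)‖ - a.im) 1, lt_min h0 one_pos, min_le_right _ _, key _ (min_le_right _ _) ?_⟩
    intro w hw
    exact (min_le_left _ _).trans (hmin w hw)
  · exact ⟨1, one_pos, le_rfl, key 1 le_rfl fun w hw => absurd ⟨w, hw⟩ hTe⟩

/-! ## §2 RUNG 1: pinning from arc-sign clearance -/

/-- ★★★ RUNG 1 — PINNING FROM ARC-SIGN CLEARANCE (`m̃(a) = 0`).  On a legal frame, an upper zero `a` of `f^{(j)}` such that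
`Im (f^{(j+1)}/f^{(j)}) < 0` on the upper half of every circle `|w − Re a| = Im a + δ`, `0 < δ < d₀`, has a NON-REAL zero of `f^{(j+1)}`
in its CLOSED Jensen disc or an NL event of level `j` in the CLOSED base — the literal conclusion of `RhW08.Lens1Pinning.TopPinning`.
[Walsh, Ann. of Math. 22 (1920) §4 on `a`'s own circle; Kim, PAMS 124 (1996) Thm 1; tree: `RhW08.Lens1ArcSign.disc_census`,
`…JensenWindow.rolleIdentity_of_localB_core`, `RhW08.QuadW.nlEventOf_of_not_localB`.] -/
theorem pinning_of_arcSignClear {η : ℝ} {f : ℂ → ℂ} {x₀ s hmax R Hs : ℝ} {B : ℕ} (hE : EngineHyps5 2 η f x₀ s hmax R Hs B)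
    {j : ℕ} {a : ℂ} (ha : iteratedDeriv j f a = 0) (hapos : 0 < a.im)
    (hsign : ∃ d0 > 0, ∀ δ ∈ Ioo 0 d0, ∀ w : ℂ, ‖w - (a.re : ℂ)‖ = a.im + δ → 0 < w.im →
      (deriv (iteratedDeriv j f) w / iteratedDeriv j f w).im < 0) :
    (∃ w : ℂ, iteratedDeriv (j + 1) f w = 0 ∧ w.im ≠ 0 ∧ NestedStep a w) ∨ (∃ x : ℝ, |x - a.re| ≤ a.im ∧ NLEventOf f j x) := by
  classical
  have hf : RealEntireLt2 f := realEntireLt2_of_hyps hE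
  obtain ⟨d0, hd0, hsg⟩ := hsign
  -- `f^{(j)} ≢ 0`: else the sign hypothesis fails at the top of the circle of radius `Im a + d₀/2`
  have hnz : iteratedDeriv j f ≠ 0 := by
    intro h0
    have hw : ‖((a.re : ℂ) + ((a.im + d0 / 2 : ℝ) : ℂ) * I) - (a.re : ℂ)‖ = a.im + d0 / 2 := by
      rw [add_sub_cancel_left, norm_mul, Complex.norm_real, Complex.norm_I, mul_one, Real.norm_eq_abs,
        abs_of_pos (by linarith)]
    have hwim : ((a.re : ℂ) + ((a.im + d0 / 2 : ℝ) : ℂ) * I).im = a.im + d0 / 2 := by simp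
    have h := hsg (d0 / 2) ⟨by linarith, by linarith⟩ _ hw (by rw [hwim]; linarith)
    rw [h0] at h
    simp at h
  set G : ℂ → ℂ := iteratedDeriv j f with hGdef
  have hG : RealEntireLt2 G :=
    { diff := differentiable_iteratedDeriv_of_entire hf.diff j
      growth := by
        obtain ⟨ρ, C, hρ0, hρ, hgr⟩ := hf.growth
        obtain ⟨ρ', C', h1, h2, h3⟩ := exists_growth_iteratedDeriv hf.diff hρ0 hρ hgr j
        exact ⟨ρ', C', h1, h2, h3⟩
      real := im_iteratedDeriv_ofReal hf.diff hf.real j }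
  have hGreal : ∀ z : ℂ, G (conj z) = conj (G z) := apply_conj_eq_conj hG.diff hG.real
  have hdreal : ∀ x : ℝ, (deriv G x).im = 0 := im_deriv_ofReal hG.diff hG.real
  have e1 : deriv G = iteratedDeriv (j + 1) f := by rw [hGdef, ← iteratedDeriv_succ]
  have hHs : 0 ≤ Hs := hE.2.2.2.2.2.2.2.1
  have hG'ne : iteratedDeriv (j + 1) f ≠ 0 := iteratedDeriv_succ_ne_zero_of_zero hf.diff j hnz ha
  have hG'd : Differentiable ℂ (iteratedDeriv (j + 1) f) := differentiable_iteratedDeriv_of_entire hf.diff (j + 1)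
  by_contra hcon
  push Not at hcon
  obtain ⟨hnoC, hnoNL⟩ := hcon
  -- the NL margin `m` and the child margin `m′`
  obtain ⟨m, hm0, hm1, hmarg⟩ := exists_nl_margin hf hG'ne hapos (a := a)
  obtain ⟨m', hm'0, hm'1, hchild⟩ := exists_child_margin hE hG'ne hapos (a := a)
  set δ₀ : ℝ := min d0 (min m m') with hδ₀
  have hδ₀0 : 0 < δ₀ := lt_min hd0 (lt_min hm0 hm'0)
  -- a GENERIC `δ ∈ (0, δ₀)`: the feet `Re a ± (Im a + δ)` miss the finitely many zeros of `G`, `G′` in the box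
  set L : ℝ := a.im + Hs + 2 with hL
  have hz₀ : ((a.re : ℂ)) ∈ Ioo (a.re - L) (a.re + L) ×ℂ Ioo (-(Hs + 1)) (Hs + 1) :=
    ofReal_mem_box (by rw [sub_self, abs_zero]; linarith) hHs
  set Z : Set ℂ := {ρ : ℂ | G ρ = 0 ∧ ρ ∈ Ioo (a.re - L) (a.re + L) ×ℂ Ioo (-(Hs + 1)) (Hs + 1)} ∪
    {ρ : ℂ | iteratedDeriv (j + 1) f ρ = 0 ∧ ρ ∈ Ioo (a.re - L) (a.re + L) ×ℂ Ioo (-(Hs + 1)) (Hs + 1)} with hZ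
  have hZfin : Z.Finite := (finite_zeros_box hG.diff hnz hz₀).union (finite_zeros_box hG'd hG'ne hz₀)
  let cp : ℝ → ℂ := fun ε => ((a.re + (a.im + ε) : ℝ) : ℂ)
  let cm : ℝ → ℂ := fun ε => ((a.re - (a.im + ε) : ℝ) : ℂ)
  have hcp : Set.InjOn cp (cp ⁻¹' Z) := fun x _ y _ h => by
    have h' : a.re + (a.im + x) = a.re + (a.im + y) := Complex.ofReal_inj.mp h
    linarith
  have hcm : Set.InjOn cm (cm ⁻¹' Z) := fun x _ y _ h => by
    have h' : a.re - (a.im + x) = a.re - (a.im + y) := Complex.ofReal_inj.mp h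
    linarith
  have hbad : (cp ⁻¹' Z ∪ cm ⁻¹' Z).Finite := (hZfin.preimage hcp).union (hZfin.preimage hcm)
  obtain ⟨δ, hδI, hδbad⟩ := ((Set.Ioo_infinite hδ₀0).sdiff hbad).nonempty
  obtain ⟨hδ0, hδ1⟩ := hδI
  have hδd0 : δ < d0 := lt_of_lt_of_le hδ1 (min_le_left _ _)
  have hδm : δ < m := lt_of_lt_of_le hδ1 ((min_le_right _ _).trans (min_le_left _ _))
  have hδm' : δ < m' := lt_of_lt_of_le hδ1 ((min_le_right _ _).trans (min_le_right _ _))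
  have hr : 0 < a.im + δ := by linarith
  have hβmem : cp δ ∈ Ioo (a.re - L) (a.re + L) ×ℂ Ioo (-(Hs + 1)) (Hs + 1) :=
    ofReal_mem_box (by rw [show a.re + (a.im + δ) - a.re = a.im + δ by ring, abs_of_pos hr]; linarith) hHs
  have hαmem : cm δ ∈ Ioo (a.re - L) (a.re + L) ×ℂ Ioo (-(Hs + 1)) (Hs + 1) :=
    ofReal_mem_box (by rw [show a.re - (a.im + δ) - a.re = -(a.im + δ) by ring, abs_neg, abs_of_pos hr]; linarith) hHs
  have hGβ : G (cp δ) ≠ 0 := fun h0 => hδbad (Or.inl (Or.inl ⟨h0, hβmem⟩))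
  have hG'β : iteratedDeriv (j + 1) f (cp δ) ≠ 0 := fun h0 => hδbad (Or.inl (Or.inr ⟨h0, hβmem⟩))
  have hGα : G (cm δ) ≠ 0 := fun h0 => hδbad (Or.inr (Or.inl ⟨h0, hαmem⟩))
  have hG'α : iteratedDeriv (j + 1) f (cm δ) ≠ 0 := fun h0 => hδbad (Or.inr (Or.inr ⟨h0, hαmem⟩))
  -- the symmetric circle sign for `G` (lower half by conjugation)
  have hsgn : ∀ w : ℂ, ‖w - ((a.re : ℝ) : ℂ)‖ = a.im + δ → w.im ≠ 0 → w.im * (deriv G w / G w).im < 0 := by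
    intro w hw hwim
    rcases lt_or_gt_of_ne hwim with hneg | hpos
    · have hw' : ‖conj w - (a.re : ℂ)‖ = a.im + δ := by
        have e : conj w - (a.re : ℂ) = conj (w - (a.re : ℂ)) := by simp [map_sub]
        rw [e, Complex.norm_conj]; exact hw
      have hpos' : 0 < (conj w).im := by rw [Complex.conj_im]; linarith
      have h := hsg δ ⟨hδ0, hδd0⟩ (conj w) hw' hpos'
      rw [apply_conj_eq_conj hG.diff.deriv hdreal w, hGreal w, ← map_div₀, Complex.conj_im] at h
      exact mul_neg_of_neg_of_pos hneg (by linarith)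
    · exact mul_neg_of_pos_of_neg hpos (hsg δ ⟨hδ0, hδd0⟩ w hw hpos)
  -- the base: local Laguerre law B, or an NL event within the margin
  by_cases hB : LocalB G (a.re - (a.im + δ)) (a.re + (a.im + δ))
  swap
  · obtain ⟨x, hx, hNL⟩ := nlEventOf_of_not_localB hf j hB
    have hxa : |x - a.re| < a.im + m := by rw [abs_lt]; constructor <;> linarith [hx.1, hx.2]
    exact hnoNL x (hmarg x hNL hxa) hNL
  -- the real Rolle identity on the base (trivial sign window: only the feet data are used)
  have hW : SWindow G (fun _ => True) (a.re - (a.im + δ)) (a.re + (a.im + δ)) (a.im + δ) :=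
    ⟨by linarith, hr, fun _ _ => trivial, fun _ _ => trivial, fun _ _ _ => trivial, fun _ _ _ => trivial,
      hGα, hGβ, by rw [e1]; exact hG'α, by rw [e1]; exact hG'β⟩
  have hRolle : RolleIdentity G (a.re - (a.im + δ)) (a.re + (a.im + δ)) (a.im + δ) :=
    rolleIdentity_of_localB_core hG.diff hG.real hW hB
  -- every critical point in the open disc is real — else it is a `NestedStep` child (excluded)
  have hA : ∀ ρ ∈ ball ((a.re : ℝ) : ℂ) (a.im + δ), deriv G ρ = 0 → ρ.im = 0 := by
    intro ρ hρ hdρ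
    by_contra hρim
    have hρ' : ‖ρ - (a.re : ℂ)‖ < a.im + m' := by
      rw [mem_ball, dist_eq_norm] at hρ; linarith
    have hdρ' : iteratedDeriv (j + 1) f ρ = 0 := by rw [← e1]; exact hdρ
    exact hnoC ρ hdρ' hρim (hchild ρ hdρ' hρim hρ')
  -- the disc Rolle closure: every zero of `G` in the disc is real — but `a` is one
  have hall := no_nonreal_zero_of_disc hG.diff hG.real hr hGα hGβ (by rw [e1]; exact hG'α) (by rw [e1]; exact hG'β)
    hsgn hA hRolle
  have haball : a ∈ ball ((a.re : ℝ) : ℂ) (a.im + δ) := by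
    rw [mem_ball, dist_eq_norm]
    have e : a - (a.re : ℂ) = ((a.im : ℝ) : ℂ) * I := Complex.ext (by simp) (by simp)
    rw [e, norm_mul, Complex.norm_real, Complex.norm_I, mul_one, Real.norm_eq_abs, abs_of_pos hapos]
    linarith
  exact absurd (hall a haball ha) hapos.ne'

/-! ## §3 Arc-sign clearance as a `Prop`; Jensen isolation is a special case -/

/-- ARC-SIGN CLEARANCE of the upper zero `a` of `f^{(j)}` (`m̃(a) = 0`): for all small `δ > 0`, `Im (f^{(j+1)}/f^{(j)}) < 0` on the
upper half of the circle `|w − Re a| = Im a + δ`. -/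
def ArcSignClear (f : ℂ → ℂ) (j : ℕ) (a : ℂ) : Prop :=
  ∃ d0 > 0, ∀ δ ∈ Ioo 0 d0, ∀ w : ℂ, ‖w - (a.re : ℂ)‖ = a.im + δ → 0 < w.im →
    (deriv (iteratedDeriv j f) w / iteratedDeriv j f w).im < 0

/-- ★ `TopPinning` IN THE ARC-SIGN-CLEAR CASE (literal conclusion of the law; no `NoTallerToucher` needed). -/
theorem topPinning_case_arcSignClear {η : ℝ} {f : ℂ → ℂ} {x₀ s hmax R Hs : ℝ} {B : ℕ} (hE : EngineHyps5 2 η f x₀ s hmax R Hs B)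
    {j : ℕ} {a : ℂ} (ha : iteratedDeriv j f a = 0) (hapos : 0 < a.im) (hS : ArcSignClear f j a) :
    (∃ w : ℂ, iteratedDeriv (j + 1) f w = 0 ∧ w.im ≠ 0 ∧ NestedStep a w) ∨ (∃ x : ℝ, |x - a.re| ≤ a.im ∧ NLEventOf f j x) :=
  pinning_of_arcSignClear hE ha hapos hS

/-- ★ JENSEN-ISOLATED ⇒ ARC-SIGN CLEAR: every point of a circle `|w − Re a| = Im a + δ`, `0 < δ < g` (`g` the uniform far gap of
`RhW08.Lens1PinningIso.exists_uniform_far_gap`), is Jensen-clear for `f^{(j)}`, so the Jensen–Nagy sign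
`…JensenWindow.im_mul_im_logDeriv_neg` gives `Im (f^{(j+1)}/f^{(j)}) < 0` on its upper half. -/
theorem arcSignClear_of_jensenIsolated {η : ℝ} {f : ℂ → ℂ} {x₀ s hmax R Hs : ℝ} {B : ℕ} (hE : EngineHyps5 2 η f x₀ s hmax R Hs B)
    {j : ℕ} {a : ℂ} (ha : iteratedDeriv j f a = 0) (hapos : 0 < a.im) (hJ : JensenIsolated f j a) : ArcSignClear f j a := by
  classical
  have hf : RealEntireLt2 f := realEntireLt2_of_hyps hE
  have hnz : iteratedDeriv j f ≠ 0 := ne_zero_of_jensenIsolated hapos hJ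
  set G : ℂ → ℂ := iteratedDeriv j f with hGdef
  have hG : RealEntireLt2 G :=
    { diff := differentiable_iteratedDeriv_of_entire hf.diff j
      growth := by
        obtain ⟨ρ, C, hρ0, hρ, hgr⟩ := hf.growth
        obtain ⟨ρ', C', h1, h2, h3⟩ := exists_growth_iteratedDeriv hf.diff hρ0 hρ hgr j
        exact ⟨ρ', C', h1, h2, h3⟩
      real := im_iteratedDeriv_ofReal hf.diff hf.real j }
  have hGreal : ∀ z : ℂ, G (conj z) = conj (G z) := apply_conj_eq_conj hG.diff hG.real
  have hstrip : ∀ c : ℂ, G c = 0 → |c.im| ≤ Hs := fun c hc => abs_im_le_of_level hE hnz hc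
  have haHs : a.im ≤ Hs := by have h := hstrip a ha; rwa [abs_of_pos hapos] at h
  obtain ⟨g, hg0, -, hgap⟩ := exists_uniform_far_gap hG.diff hnz hstrip hapos haHs
  obtain ⟨ρ, C, hρ0, hρ, hgr⟩ := hG.growth
  refine ⟨g, hg0, fun δ hδ w hw hwpos => ?_⟩
  have hclear : JensenClear G w := by
    intro c hc hcim
    obtain ⟨c', hc', hc'pos, hc're, hc'im⟩ : ∃ c' : ℂ, G c' = 0 ∧ 0 < c'.im ∧ c'.re = c.re ∧ c'.im = |c.im| := by
      rcases lt_or_gt_of_ne hcim with hneg | hpos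
      · refine ⟨conj c, by rw [hGreal, hc, map_zero], by simpa using hneg, by simp, ?_⟩
        rw [Complex.conj_im, abs_of_neg hneg]
      · exact ⟨c, hc, hpos, rfl, (abs_of_pos hpos).symm⟩
    have htri1 : ‖w - (a.re : ℂ)‖ ≤ ‖w - (c.re : ℂ)‖ + |a.re - c.re| := by
      have h := norm_sub_le (w - (c.re : ℂ)) ((a.re : ℂ) - (c.re : ℂ))
      rw [sub_sub_sub_cancel_right, ← ofReal_sub, Complex.norm_real, Real.norm_eq_abs] at h
      exact h
    have htri2 : |a.re - c.re| ≤ ‖w - (c.re : ℂ)‖ + ‖w - (a.re : ℂ)‖ := by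
      have h := norm_sub_le (w - (c.re : ℂ)) (w - (a.re : ℂ))
      rw [sub_sub_sub_cancel_left, ← ofReal_sub, Complex.norm_real, Real.norm_eq_abs] at h
      exact h
    by_cases hca : c' = a
    · have hre : c.re = a.re := by rw [← hc're, hca]
      have him : |c.im| = a.im := by rw [← hc'im, hca]
      rw [him, hre, hw]
      linarith [hδ.1]
    · rcases hJ c' hc' hc'pos hca with hfar | hnest
      · rw [hc're, hc'im] at hfar
        have hg' := hgap c hc hfar
        rw [hw] at htri2
        linarith [hδ.2]
      · rw [hc're, hc'im] at hnest
        rw [hw] at htri1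
        linarith [hδ.1]
  have h := im_mul_im_logDeriv_neg hG.diff hρ0 hρ hgr hG.real ⟨a, ha⟩ hwpos.ne' hclear
  rcases mul_neg_iff.mp h with h' | h'
  · exact h'.2
  · exact absurd h'.1 (not_lt.mpr hwpos.le)

/-! ## §4 The typed residual after RUNG 1 -/

/-- The ARC residual of the law: `TopPinning` restricted to zeros that are NEITHER Jensen-isolated NOR arc-sign clear (crossing
lower-or-equal mates with `m̃(a) ≥ 1`: `f^{(j+1)}/f^{(j)}` takes a real value on the upper half of arbitrarily small Jensen circles).
OPEN statement. -/
def TopPinningArcResidual : Prop :=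
  ∀ (η : ℝ) (f : ℂ → ℂ) (x₀ s hmax R Hs : ℝ) (B : ℕ), EngineHyps5 2 η f x₀ s hmax R Hs B → ∀ (j : ℕ) (a : ℂ),
    iteratedDeriv j f a = 0 → 0 < a.im → NoTallerToucher f j a → ¬ JensenIsolated f j a → ¬ ArcSignClear f j a →
    (∃ w : ℂ, iteratedDeriv (j + 1) f w = 0 ∧ w.im ≠ 0 ∧ NestedStep a w) ∨ (∃ x : ℝ, |x - a.re| ≤ a.im ∧ NLEventOf f j x)

/-- ★ EXACT SPLIT: the crossing residual follows from the arc residual (RUNG 1 discharges the arc-sign-clear crossing frames). -/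
theorem topPinningCrossing_of_arcResidual (hA : TopPinningArcResidual) : TopPinningCrossing := by
  intro η f x₀ s hmax R Hs B hE j a ha hapos hN hJ
  by_cases hS : ArcSignClear f j a
  · exact pinning_of_arcSignClear hE ha hapos hS
  · exact hA η f x₀ s hmax R Hs B hE j a ha hapos hN hJ hS

/-- ★ The law from the arc residual. -/
theorem topPinning_of_arcResidual (hA : TopPinningArcResidual) : TopPinning :=
  topPinning_of_crossing (topPinningCrossing_of_arcResidual hA)

/-- Converse (bookkeeping): the split is exact. -/
theorem arcResidual_of_topPinning (hP : TopPinning) : TopPinningArcResidual :=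
  fun η f x₀ s hmax R Hs B hE j a ha hapos hN _ _ => hP η f x₀ s hmax R Hs B hE j a ha hapos hN

end RhW08.Lens1ArcSign
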